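import Summits.QuantumFields.BalabanUV.T4Continuum.Spine.NE5.TwoRunTorusWalkOutputLetters
import Summits.QuantumFields.BalabanUV.T4Continuum.Spine.NE5.TwoRunTorusNE5Pencil

/-!
# Spine/NE5/TwoRunTorusNE5Records — `T4OutputRate.NE5` BY NAME from per-scale, per-term WALK RECORDS + SYMMETRY, the
# operator letters read from the records: the MINIMAL gate list of row NE5 in ONE theorem (cell `pub-balaban-gaps`, seat `ne5` gen 11)

WHY.  T37 `TwoRunTorusNE5Terms.ne5_of_termWalkData_all_scales` (§2) reads the END of the chain from per-scale per-term
walk records through T26 §1, whose binder list still contains three items that the records themselves supply: NODE A's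
positivity `Re A(σ,b) ≻ 0`, the spectral letter `λ_max(C) ≤ c_E` and the Γ₀-form letter — all DERIVED from
`TermWalkData` + symmetry + one smallness by T28 `TwoRunTorusWalkRePos` and consumed in that form by T29
`TwoRunTorusWalkOutputLetters.differentiableOn_E_torus_of_records_symm`.  THIS FILE is T37 §2 with T29 as the per-scale
producer: `ne5_of_records_symm_all_scales`.  Its binder list is the MINIMAL gate list of the row in the cell's currency —
(a) NODE O: ONE record `𝒦 j Z t φ` per term per scale over the two-run pencil with `TermWalkData (𝒦 j Z t φ) (w j)`, plus
σ-holomorphy of its kernels (located point (x12): free for NODE O's model families by T27 ∕ T33, for Bałaban's walk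
series via termwise σ-holomorphy + majorants); (b) rows NE2∕NE3: ONE package per scale admissible at `α j > 1` with
`s∕θ^j ≤ α j` wherever `θ^j < s`, `SmallTheta (w j) (α j) ϑ` (satisfiable with scale-independent letters iff the records'
configuration radius grows like `s∕θ^j`: T38 `TwoRunTorusNE5Windows.windows_of_thresholds`); (c) the adapter:
SYMMETRY of the precision (NODE A; trivial for the parametrix family), potentials with (2.20), common `χ` with (2.22), a
column fibre bound ((x10)), the envelopes `c_E, g` FROM BELOW in the records' letters with NODE A's positivity smallness,
rates and the p. 17 numerics (T34's threshold form), Lemma 3's and (2.39)–(2.41)'s numbers once; activities by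
summation and outputs by (2.13) are definitions.

HONEST FRAMING.  Pure composition of LANDED shapes (T29, T30); every torus model, record, region and number is a
HYPOTHESIS; nothing of Bałaban's `E^{(j)}`, `C^{(k)}(Z₀,σ)`, `Γ_k`, `𝐕_k` is constructed or asserted; whether Bałaban's
two runs admit such records with the window `s∕θ^j` is NODE O's statement (v) together with rows NE2∕NE3's primitive
two-run rate, not claimed here; NE5 NOT PRINTED ∕ NOT PROVED; leaves 0∕12; (D4) 0∕1; spine 0∕9.  Rung (B)+1 on a FIXED
finite T⁴ — NOT continuum, NOT infinite volume, NOT mass gap, NOT Clay.  HONEST DEPENDENCY: continuum YM on T⁴ ⇐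
BetaPertH ∧ nine spine estimates; BetaPertH ⇐ (D1) ∧ (D4) ∧ CAP+tail.  0 sorry, 0 `def`.

Sources: [I] = T. Bałaban, CMP **109** (1987) [Balaban1987RG1] (0.24)–(0.25) p. 257, (1.18) p. 263; [II] = CMP **116**
(1988) [Balaban1988RG2Cluster] (1.11) p. 5, p. 13, p. 15, (2.13)–(2.26) pp. 14–17, Lemma 3 (2.38) p. 20, (2.41) p. 21;
[B9] = CMP **99** (1985) [Balaban1985BackgroundPropagators] Thm 3.10 p. 416; C. King, CMP **102** (1986) [King1986]
Thm 3.4 p. 656, p. 665.  Nothing here is a claim about the Yang–Mills mass gap.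
-/

noncomputable section

namespace Summit.QuantumFields.BalabanUV.T4Continuum.Spine.NE5.TwoRunTorusNE5Records

open Matrix Metric Set Finset
open Literature.MathematicalPhysics.QuantumFieldTheory.Balaban1983to89
open Literature.MathematicalPhysics.QuantumFieldTheory.Balaban1983to89.T4OutputRate (NE5)
open Literature.MathematicalPhysics.QuantumFieldTheory.Balaban1983to89.TreeLengthTorus (TPt TDom tsys)
open Literature.MathematicalPhysics.QuantumFieldTheory.Balaban1983to89.TreeLengthTorusGeometry (TTouch)
open Literature.MathematicalPhysics.QuantumFieldTheory.Balaban1983to89.TreeLengthTorusTransfer (tclosure)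
open Literature.MathematicalPhysics.QuantumFieldTheory.Balaban1983to89.B13Lemma3TorusData (TBond)
open Literature.MathematicalPhysics.QuantumFieldTheory.Balaban1983to89.B13Lemma3Torus (TwoTorusStep)
open Literature.MathematicalPhysics.QuantumFieldTheory.Balaban1983to89.B13Lemma3TorusTerms (terms weight Z0)
open Literature.MathematicalPhysics.QuantumFieldTheory.Balaban1983to89.B13Term214 (core214 F214 term214)
open Literature.MathematicalPhysics.QuantumFieldTheory.Balaban1983to89.B13Bound143 (invTau)
open Literature.MathematicalPhysics.QuantumFieldTheory.Balaban1983to89.B5TorusCover (UT)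
open Literature.MathematicalPhysics.QuantumFieldTheory.Balaban1983to89.B12TreeDecay (kappa₀ K₀)
open Literature.MathematicalPhysics.QuantumFieldTheory.Balaban1983to89.B13Resummation (locE)
open Literature.MathematicalPhysics.QuantumFieldTheory.Balaban1983to89.B13TermWalkData
  (WalkConsts TermKernels TermWalkData)
open Literature.MathematicalPhysics.QuantumFieldTheory.Balaban1983to89.B13TermWalkDataOneTorus (SmallTheta)
open Summit.QuantumFields.BalabanUV.T4Continuum.Spine.NE5.TwoRunTorusWalkOutputLetters
  (differentiableOn_E_torus_of_records_symm)
open Summit.QuantumFields.BalabanUV.T4Continuum.Spine.NE5.TwoRunTorusNE5 (torusCarriers reFunctional)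
open Summit.QuantumFields.BalabanUV.T4Continuum.Spine.NE5.TwoRunTorusNE5Pencil (ne5_of_output_pencils)

variable {L : ℕ} [NeZero L] {M : ℕ} [NeZero M]
variable {ν : ℕ} {Nf : ℕ → Fin ν → ℕ} [∀ j i, NeZero (Nf j i)]

open Classical in
/-- **`T4OutputRate.NE5` BY NAME FROM PER-SCALE, PER-TERM WALK RECORDS AT `c⁺` + SYMMETRY, THE OPERATOR LETTERS
READ FROM THE RECORDS** (T37 §2 with the per-scale producer T26 §1 replaced by T29
`TwoRunTorusWalkOutputLetters.differentiableOn_E_torus_of_records_symm`, then T30).  Compared with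
`TwoRunTorusNE5Terms.ne5_of_termWalkData_all_scales` the binders `hA` (NODE A's positivity `Re A ≻ 0`), `hc0 ∕ hc` (the
spectral letter) and `hg ∕ hΓq` (the Γ₀-form letter) are GONE — T28 derives them from the records + symmetry — and the
only new binders are the envelopes `hcE : K̄_C·m·(1+2∕κ)^ν ≤ c_E`, `hgE : c_E·(K̄_Γ·m·(1+2∕κ)^ν)² ≤ g` and NODE A's
positivity smallness `hsmallRe : θ_E(w j, α j)·(m·(1+2∕κ)^ν)·c_E < 1` per scale, in the records' letters.  Everything
else as in T37 §2: per scale `j` ONE package `w j` admissible at `α j > 1` with `s∕θ^j ≤ α j` wherever `θ^j < s` and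
`SmallTheta (w j) (α j) ϑ`, σ-holomorphy of the kernels, SYMMETRY of the precision, potentials with (2.20), common
`χ, χᶜ, 𝐃` with (2.22), a column fibre bound, rates and the p. 17 numerics, Lemma 3's and (2.39)–(2.41)'s numbers once,
activities by summation, outputs by (2.13).  Conclusion: `NE5 (reFunctional N W (E · 0)) (reFunctional N W (E · 1)) W′
((1−10δ)½Lκ) θ (2·(A₂C₃ε₁)∕s)` for every coupling window.  This is the MINIMAL gate list of row NE5 on the carrier in
the cell's currency: (v)⁺ records per term per scale (NODE O) + σ-holomorphy (located point (x12)) + symmetry; the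
window (rows NE2∕NE3); the non-walk data (potentials ∕ χ ∕ column fibre) and envelope ∕ numerics letters (the adapter).
[cite: Balaban1987RG1, (0.24)–(0.25) p.257, (1.18) p.263; Balaban1988RG2Cluster, (1.11) p.5, p.13, p.15, (2.13)–(2.26) pp.14–17, (2.38) p.20, (2.41) p.21; Balaban1985BackgroundPropagators, Thm 3.10 p.416; King1986, Thm 3.4 p.656, p.665] -/

theorem ne5_of_records_symm_all_scales (c : B13.Consts) (hL : 8 ≤ c.L) (hLc : c.L = L) (hκ₁ : 1 ≤ c.κ₁)
    (hα₆' : c.α₆ ≠ 0) (N : ℕ → ℕ) [∀ j, NeZero (N j)] (W : (j : ℕ) → TwoTorusStep 4 L (N j))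
    {θ s : ℝ} (hθ : 0 < θ) (hs : 0 < s)
    -- regions, radii, contour radius, parameter lists, per scale
    (hpos : ∀ j, ∀ Y : TDom 4 (L * N j), 0 < invTau c ((tsys 4 (L * N j)).dj Y))
    (hhalf : ∀ j, ∀ Y : TDom 4 (L * N j), invTau c ((tsys 4 (L * N j)).dj Y) ≤ 1 / 2)
    {Uτ : (j : ℕ) → TDom 4 (L * N j) → Set ℂ} (hUτ : ∀ j Y, IsOpen (Uτ j Y))
    (hUtau : ∀ j, ∀ Y : TDom 4 (L * N j), closedBall (0 : ℂ) ((invTau c ((tsys 4 (L * N j)).dj Y))⁻¹) ⊆ Uτ j Y)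
    {r : ℝ} (hr : 0 < r) (hr' : r ≤ Real.exp c.κ₁ - 1)
    (hsubτ : ∀ j Y, ∀ ζ ∈ Set.uIcc (0 : ℝ) 1, closedBall (ζ : ℂ) r ⊆ Uτ j Y)
    (lZ : (j : ℕ) → TDom 4 (N j) → Finset (TDom 4 (L * N j)) × Finset (TBond 4 M (L * N j)) → List (TPt 4 (N j)))
    (hlZ : ∀ j Z t, (lZ j Z t).Nodup ∧ (lZ j Z t).toFinset = Z.1 \ tclosure L (N j) (Z0 M t))
    (lD : (j : ℕ) → Finset (TDom 4 (L * N j)) × Finset (TBond 4 M (L * N j)) → List (TDom 4 (L * N j)))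
    (hlD : ∀ j t, (lD j t).Nodup ∧ (lD j t).toFinset = t.1)
    -- PER-SCALE, PER-TERM WALK RECORDS AT `c⁺` OVER THE PENCIL, ONE ADMISSIBLE PACKAGE PER SCALE AT THE WINDOW SIZE
    (𝒦 : (j : ℕ) → (Z : TDom 4 (N j)) → Finset (TDom 4 (L * N j)) × Finset (TBond 4 M (L * N j)) → (W j).Φ →
      TermKernels ({ c with κ₁ := c.κ₁ + 1 } : B13.Consts) 4 (N j) ν (Nf j) ℂ)
    [∀ j Z t φ, Fintype (𝒦 j Z t φ).C₀] [∀ j Z t φ, DecidableEq (𝒦 j Z t φ).C₀]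
    {w : ℕ → WalkConsts} {α Rσ₀ : ℕ → ℝ} (hw : ∀ j, (w j).Admissible (α j) (Rσ₀ j))
    (hα1 : ∀ j, 1 < α j) (hαs : ∀ j, θ ^ j < s → s / θ ^ j ≤ α j)
    (h𝒦 : ∀ j Z, ∀ t ∈ terms L M Z, ∀ φ, φ ∈ (W j).sp2 Z → TermWalkData (𝒦 j Z t φ) (w j))
    (Γ : (j : ℕ) → (Z : TDom 4 (N j)) → (t : Finset (TDom 4 (L * N j)) × Finset (TBond 4 M (L * N j))) →
      (φ : (W j).Φ) → ℂ → (TPt 4 (N j) → ℂ) → ((𝒦 j Z t φ).Λ ⊕ (𝒦 j Z t φ).C₀ → ℝ) → ((𝒦 j Z t φ).Λ → ℂ))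
    (hlin : ∀ j Z, ∀ t ∈ terms L M Z, ∀ φ, φ ∈ (W j).sp2 Z → ∀ b ∈ ball (0 : ℂ) (α j), ∀ σ : TPt 4 (N j) → ℂ,
      (∀ i, σ i ∈ ball (0 : ℂ) (Real.exp (c.κ₁ + 1))) →
        ∀ X : (𝒦 j Z t φ).Λ ⊕ (𝒦 j Z t φ).C₀ → ℝ, Γ j Z t φ b σ X = (𝒦 j Z t φ).G2 σ b *ᵥ fun i => (X i : ℂ))
    (χY₀ χcP : (j : ℕ) → (Z : TDom 4 (N j)) → (t : Finset (TDom 4 (L * N j)) × Finset (TBond 4 M (L * N j))) →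
      (φ : (W j).Φ) → ((𝒦 j Z t φ).Λ → ℝ) → ℝ)
    (hχ0 : ∀ j Z t φ Bf, 0 ≤ χY₀ j Z t φ Bf) (hχc0 : ∀ j Z t φ Bf, 0 ≤ χcP j Z t φ Bf)
    (Dfam : (j : ℕ) → TDom 4 (N j) → Finset (TDom 4 (L * N j)) × Finset (TBond 4 M (L * N j)) →
      Finset (TDom 4 (L * N j)))
    (Vk : (j : ℕ) → (Z : TDom 4 (N j)) → (t : Finset (TDom 4 (L * N j)) × Finset (TBond 4 M (L * N j))) →
      (φ : (W j).Φ) → ℂ → TDom 4 (L * N j) → ((𝒦 j Z t φ).Λ → ℝ) → ℂ)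
    -- non-walk data per scale: σ-holomorphy (NODE O), SYMMETRY (NODE A; `Re ≻ 0` is read from the record), potentials
    (hAhol : ∀ j Z, ∀ t ∈ terms L M Z, ∀ φ, φ ∈ (W j).sp2 Z → ∀ b ∈ ball (0 : ℂ) (α j), ∀ i i',
      DifferentiableOn ℂ (fun σ => (𝒦 j Z t φ).A2 σ b i i')
        {σ | ∀ i, σ i ∈ ball (0 : ℂ) (Real.exp (c.κ₁ + 1))})
    (hGhol : ∀ j Z, ∀ t ∈ terms L M Z, ∀ φ, φ ∈ (W j).sp2 Z → ∀ b ∈ ball (0 : ℂ) (α j), ∀ i i',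
      DifferentiableOn ℂ (fun σ => (𝒦 j Z t φ).G2 σ b i i')
        {σ | ∀ i, σ i ∈ ball (0 : ℂ) (Real.exp (c.κ₁ + 1))})
    (hVholb : ∀ j Z, ∀ t ∈ terms L M Z, ∀ φ, φ ∈ (W j).sp2 Z → ∀ Y Bf,
      DifferentiableOn ℂ (fun b => Vk j Z t φ b Y Bf) (ball (0 : ℂ) (α j)))
    (hχm : ∀ j Z t φ, Measurable (χY₀ j Z t φ)) (hχcm : ∀ j Z t φ, Measurable (χcP j Z t φ))
    (hVm : ∀ j Z, ∀ t ∈ terms L M Z, ∀ φ, φ ∈ (W j).sp2 Z → ∀ b ∈ ball (0 : ℂ) (α j), ∀ Y,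
      Measurable (Vk j Z t φ b Y))
    (hAs : ∀ j Z, ∀ t ∈ terms L M Z, ∀ φ, φ ∈ (W j).sp2 Z → ∀ b : ℂ, ‖b‖ ≤ α j → ∀ σ : TPt 4 (N j) → ℂ,
      (∀ i, ‖σ i‖ ≤ Real.exp (c.κ₁ + 1)) → ((𝒦 j Z t φ).A2 σ b).IsSymm)
    -- (2.22) and (2.20), uniform along the pencil, per scale
    {γ₂ rP a₂₀ w₂₀ : ℝ}
    (qP : (j : ℕ) → (Z : TDom 4 (N j)) → (t : Finset (TDom 4 (L * N j)) × Finset (TBond 4 M (L * N j))) →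
      (φ : (W j).Φ) → ((𝒦 j Z t φ).Λ → ℝ) → ℝ)
    (h222 : ∀ j Z t φ Bf, χY₀ j Z t φ Bf * χcP j Z t φ Bf ≤
      Real.exp (-(γ₂ / 2 * rP ^ 2 * (t.2.card : ℕ)) + γ₂ / 2 * qP j Z t φ Bf))
    (hγ₂ : 0 ≤ γ₂) (hqP : ∀ j Z t φ Bf, qP j Z t φ Bf ≤ Bf ⬝ᵥ Bf) (ha0 : 0 ≤ a₂₀)
    (h220U : ∀ j Z, ∀ t ∈ terms L M Z, ∀ φ, φ ∈ (W j).sp2 Z → ∀ b ∈ ball (0 : ℂ) (α j),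
      ∀ τ : TDom 4 (L * N j) → ℂ, (∀ Y, τ Y ∈ Uτ j Y) →
        ∀ Bf, ∑ Y ∈ Dfam j Z t, ‖τ Y‖ * ‖Vk j Z t φ b Y Bf‖ ≤ a₂₀ / 2 * (Bf ⬝ᵥ Bf) + w₂₀)
    -- a common fibre bound
    {m : ℕ} (hm : ∀ j Z t φ, (𝒦 j Z t φ).m ≤ m)
    (hfibN : ∀ j Z t φ, ∀ x : UT (Nf j), (Finset.univ.filter fun i => (𝒦 j Z t φ).locN i = x).card ≤ m)
    -- one package of rates, NODE A's smallness `ϑ` BY NAME per scale, the p. 17 numerics in the records' letters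
    {κa κb kap' kap'' ϑ : ℝ} (hκa : ∀ j, κa < (w j).kap) (hκb : κb < κa) (h2 : kap' < κb) (h1 : kap'' < kap')
    (hkap'' : 0 < kap'')
    (hsm : ∀ j, SmallTheta (w j) (α j) ϑ)
    (hθR1le : ∀ j Z t φ, ((m : ℝ) * (1 + 2 / (κb - kap')) ^ ν) * (m * (1 + 2 / (kap' - kap'')) ^ ν)
      * ((2 * (w j).KbarΓ * Real.exp (-((w j).ε * (w j).Rσ)) + 2 * (w j).KbarΓ * α j / (w j).R) * (w j).KbarC
          * (w j).KbarΓ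
        + (w j).KbarΓ * ((w j).KbarC * (2 * (w j).KbarE * Real.exp (-((w j).ε * (w j).Rσ))
            + 2 * (w j).KbarE * α j / (w j).R)
            * ((𝒦 j Z t φ).m * (1 + 2 / ((w j).kap - κa)) ^ ν) * (w j).KbarC
            * ((𝒦 j Z t φ).m * (1 + 2 / (κa - κb)) ^ ν)) * (w j).KbarΓ
        + (w j).KbarΓ * (w j).KbarC * (2 * (w j).KbarΓ * Real.exp (-((w j).ε * (w j).Rσ))
            + 2 * (w j).KbarΓ * α j / (w j).R)) ≤ ϑ)
    (hsmallKθ : ∀ j, (w j).KbarC * (m * (1 + 2 / κb) ^ ν) * (ϑ * (m * (1 + 2 / kap'') ^ ν)) < 1)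
    -- the operator letters `c_E`, `g` constrained FROM BELOW by the records' letters (T28), NODE A's positivity smallness
    {cE g : ℝ} (hcE : ∀ j, (w j).KbarC * (m * (1 + 2 / (w j).kap) ^ ν) ≤ cE)
    (hgE : ∀ j, cE * ((w j).KbarΓ * (m * (1 + 2 / (w j).kap) ^ ν)) ^ 2 ≤ g)
    (hsmallRe : ∀ j, (2 * (w j).KbarE * Real.exp (-((w j).ε * (w j).Rσ)) + 2 * (w j).KbarE * α j / (w j).R)
      * (m * (1 + 2 / (w j).kap) ^ ν) * cE < 1)
    (hαc : (2 * (ϑ * (m * (1 + 2 / kap'') ^ ν)) + (γ₂ + a₂₀)) * cE ≤ 1 / 2)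
    (hsmall : (2 * (ϑ * (m * (1 + 2 / kap'') ^ ν)) + (γ₂ + a₂₀)) * (1 + 2 * cE * g) ≤ 1 / 2)
    {a a₅ : ℝ} (hPa : a ≤ γ₂ * rP ^ 2)
    (hvol : ∀ j Z, ∀ t ∈ terms L M Z, ∀ φ, φ ∈ (W j).sp2 Z →
      2 * ((w j).KbarC * (m * (1 + 2 / κb) ^ ν) * (ϑ * (m * (1 + 2 / kap'') ^ ν))
              * (1 + (1 - (w j).KbarC * (m * (1 + 2 / κb) ^ ν) * (ϑ * (m * (1 + 2 / kap'') ^ ν)))⁻¹) / 2)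
          * (Fintype.card (𝒦 j Z t φ).Λ : ℝ)
        + w₂₀ + (2 * (ϑ * (m * (1 + 2 / kap'') ^ ν)) + (γ₂ + a₂₀)) * cE * (Fintype.card (𝒦 j Z t φ).Λ : ℝ)
        + (2 * (ϑ * (m * (1 + 2 / kap'') ^ ν)) + (γ₂ + a₂₀)) * (1 + 2 * cE * g)
          * (Fintype.card ((𝒦 j Z t φ).Λ ⊕ (𝒦 j Z t φ).C₀) : ℝ)
        ≤ a₅ * ((Z.1).card : ℝ))
    -- Lemma 3's and (2.39)–(2.41)'s numbers, once (verbatim T17)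
    {a₂ a₂' Aabs : ℝ}
    (hα₆ : 0 < c.α₆) (hε₀ : 0 ≤ c.eps2) (hδ : 0 ≤ c.δ) (hδ7 : 0 ≤ 1 - 7 * c.δ) (hκ : 0 ≤ c.κ) (ha : 0 ≤ a)
    (hR15 : c.R15) (hR16 : 18 * ((1 - 4 * c.δ) * c.κ) ≤ a / 20) (hR16' : 4 * c.κ ≤ a / 20)
    (hR17 : Real.exp (-(a / 20)) ≤ c.eps2) (h231 : 2 * (4 : ℝ) * (M : ℝ) ^ 4 * Real.exp (-(a / 10)) ≤ a / 20)
    (ha₂ : 0 ≤ a₂) (hκ229 : kappa₀ 64 8 + a₂ ≤ c.δ * c.κ)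
    (hsm229 : c.α₆ * Real.exp a₂ * K₀ 64 8 * 64 ≤ a₂)
    (habsk : Real.exp (-(a / 20)) * 64 ≤ c.δ * c.κ)
    (h18half : B13Step237.R18half c (K₀ 64 8 * Real.exp (Real.exp (-(a / 20)) * 64)))
    (h18 : B13Step237.R18sharp c (K₀ 64 8 * Real.exp (Real.exp (-(a / 20)) * 64)) ((c.L : ℝ) / 2))
    (ha₂' : 0 ≤ a₂') (hκ229' : kappa₀ 64 8 + a₂' ≤ c.δ * ((c.L : ℝ) / 2) * c.κ)
    (hsm229' : c.α₆ * Real.exp a₂' * K₀ 64 8 * 64 ≤ a₂')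
    (hR20 : 18 * ((1 - 7 * c.δ) * ((c.L : ℝ) / 2) * c.κ) ≤ (c.κ₁ - 1) / 2)
    (ha₅ : 0 ≤ a₅) (habs : a₅ + Real.exp (-((c.κ₁ - 1) / 2)) ≤ Aabs)
    (hAc : Aabs * 64 ≤ c.δ * ((c.L : ℝ) / 2) * c.κ)
    (hC3 : B13Step237.bracketF c (K₀ 64 8 * Real.exp (Real.exp (-(a / 20)) * 64)) / c.α₆ *
      Real.exp (Aabs * 64) ≤ c.C3act * c.ε₁)
    -- the members' activities are the sums of the (2.14)-terms read from the records; (2.13); space restriction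
    {H : (j : ℕ) → ℂ → TDom 4 (N j) → (W j).Φ → ℂ}
    (hH : ∀ j, ∀ b ∈ ball (0 : ℂ) (α j), ∀ (Z : TDom 4 (N j)) (φ : (W j).Φ), φ ∈ (W j).sp2 Z →
      H j b Z φ = ∑ t ∈ terms L M Z,
        term214 r (lZ j Z t) (lD j t) (core214 (fun σ => (𝒦 j Z t φ).A2 σ b) (Γ j Z t φ b)
          (F214 t.2.card (χY₀ j Z t φ) (χcP j Z t φ) (Dfam j Z t) (Vk j Z t φ b))) 0 0)
    (hsp : ∀ j, ∀ X Z : TDom 4 (N j), ∀ φ, Z.1 ⊆ X.1 → φ ∈ (W j).sp2 X → φ ∈ (W j).sp2 Z)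
    {E : (j : ℕ) → ℂ → TDom 4 (N j) → (W j).Φ → ℂ}
    (h213 : ∀ j, ∀ b ∈ ball (0 : ℂ) (α j), ∀ (X : TDom 4 (N j)) (φ : (W j).Φ), φ ∈ (W j).sp2 X →
      E j b X φ = locE (TTouch (d := 4) (N := N j)) (fun Z : TDom 4 (N j) => Z.1) (fun Z => H j b Z φ) X.1)
    (hAct : 0 ≤ c.C3act * c.ε₁) (hr₁ : 0 ≤ (1 - 10 * c.δ) * ((c.L : ℝ) / 2) * c.κ)
    (hlarge : (1 - 10 * c.δ) * ((c.L : ℝ) / 2) * c.κ + 2 * (64 * Real.log 162) + 2 ≤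
      (1 - 8 * c.δ) * ((c.L : ℝ) / 2) * c.κ)
    (hsmall41 : c.C3act * c.ε₁ * Real.exp (5 * ((1 - 10 * c.δ) * ((c.L : ℝ) / 2) * c.κ) + 1) * K₀ 64 8 * 9 * 64 ≤ 1)
    (hA₂ : Real.exp 1 * 9 * 64 * K₀ 64 8 ^ 2 ≤ c.A₂) (W' : Set (ℕ → ℝ)) :
    NE5 (C := torusCarriers N W) (reFunctional N W fun j => E j 0) (reFunctional N W fun j => E j 1) W'
      ((1 - 10 * c.δ) * ((c.L : ℝ) / 2) * c.κ) θ (2 * (c.A₂ * c.C3act * c.ε₁) / s) := by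
  -- the envelope constant is non-negative
  have hAp : 0 ≤ c.A₂ * c.C3act * c.ε₁ := by
    have hA₂0 : 0 ≤ c.A₂ := le_trans (by positivity) hA₂
    rw [mul_assoc]
    exact mul_nonneg hA₂0 hAct
  -- T29 at every scale: the output pencil on `ball 0 (α j)` from the records + symmetry, letters from the records
  have key : ∀ (j : ℕ) (X : TDom 4 (N j)) (φ : (W j).Φ), φ ∈ (W j).sp2 X →
      DifferentiableOn ℂ (fun b => E j b X φ) (ball (0 : ℂ) (α j)) ∧
        ∀ b ∈ ball (0 : ℂ) (α j), ‖E j b X φ‖ ≤ c.A₂ * c.C3act * c.ε₁ *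
          Real.exp (-((1 - 10 * c.δ) * ((c.L : ℝ) / 2) * c.κ * (tsys 4 (N j)).dj X)) := fun j =>
    differentiableOn_E_torus_of_records_symm c hL hLc hκ₁ hα₆' (W j) (hpos j) (hhalf j) (hUτ j) (hUtau j) hr hr'
      (hsubτ j) (lZ j) (hlZ j) (lD j) (hlD j) (𝒦 j) (hw j) (one_pos.trans (hα1 j)) (h𝒦 j) (Γ j) (hlin j) (χY₀ j)
      (χcP j) (hχ0 j) (hχc0 j) (Dfam j) (Vk j) (hAhol j) (hGhol j) (hVholb j) (hχm j) (hχcm j) (hVm j) (hAs j)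
      (qP j) (h222 j) hγ₂ (hqP j) ha0 (h220U j) (hm j) (hfibN j) (hκa j) hκb h2 h1 hkap'' (hsm j) (hθR1le j)
      (hsmallKθ j) (hcE j) (hgE j) (hsmallRe j) hαc hsmall hPa (hvol j) hα₆ hε₀ hδ hδ7 hκ ha hR15 hR16 hR16' hR17
      h231 ha₂ hκ229 hsm229 habsk h18half h18 ha₂' hκ229' hsm229' hR20 ha₅ habs hAc hC3 (hH j) (hsp j) (h213 j) hAct
      hr₁ hlarge hsmall41 hA₂
  -- T30: the members at every scale, the window where `θ^j < s`
  refine ne5_of_output_pencils N W E hAp hθ hs (fun j X φ hφ => ?_) (fun j hj X φ hφ => ?_) W'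
  · exact ⟨(key j X φ hφ).2 0 (mem_ball_self (one_pos.trans (hα1 j))),
      (key j X φ hφ).2 1 (by simpa using hα1 j)⟩
  · exact ⟨(key j X φ hφ).1.mono (ball_subset_ball (hαs j hj)),
      fun b hb => (key j X φ hφ).2 b (ball_subset_ball (hαs j hj) hb)⟩

end Summit.QuantumFields.BalabanUV.T4Continuum.Spine.NE5.TwoRunTorusNE5Records

end
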